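import Literature.AlgebraicGeometry.Resolution.NormalCrossingsBlowupStepReductionProofs
import HarnessLib

/-!
# De Jong 1996, 7.2 (canonical strictification), step 2: the regular pieces of `φ⁻¹(F ∪ C)`

Route `ResolutionOfSingularities/WildQuotients`, crux `SummitReduction`
(stmt-ResolutionOfSingularities-16324), line `FramePerfect`, stub
`stub_pair_canonicalStrictification`. Helper file 2 (see helper file 1,
`…StubPairCanonicalStrictificationLemmas.lean`, for the context).

De Jong's `G`-strictness argument (1996, 7.2, p. 88: "all the components in one `G`-orbit … are of
the same type, i.e. they correspond to components of `D^(i)` for a fixed `i`. By the above these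
do not intersect") is rendered through the following invariant of the tree's recipe: the marked
strict part `F` is a union of closed `G`-stable REGULAR PIECES — closed subsets `P` whose ideal at
each of their points is generated by one element of a regular system of parameters (so that `P`
is locally irreducible). This file PROVES that one round `φ : S₁ → S` (any blowing up of the
canonical centre `C = topStratum S Z F m`) preserves the invariant, from the local equations of
`φ⁻¹(F ∪ C)` (`ncBlowupTopStratum`, restated here as the hypothesis `hpt` to keep the files
independent):

* `exists_generator_exceptional`, `not_isUnit_of_mem_centre` — a local equation `g₀` of the
  exceptional divisor; it is not a unit over the centre;
* `isStrictNormalCrossingsDivisor_preimage_union` — `φ⁻¹(F ∪ C)` is a strict normal crossings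
  divisor (as in `DeJong1996NormalCrossingsBlowupStep.of_sncBlowupTopStratum`);
* `regularPiece_exceptional` — the exceptional divisor `φ⁻¹C` is a regular piece;
* `regularPiece_preimage` — the preimage `φ⁻¹P` of a regular piece `P ⊆ F` is a regular piece;
* `mem_maxPoints_of_aut`, `image_eq_of_regularPieces` — **`G`-strictness**: an irreducible
  component of a closed union of `σ`-stable closed locally irreducible pieces that meets its
  `σ`-translate equals it (generic points and the primes `𝔭_η ⊆ 𝒪_{S,t}` of `SncStrata.lean`);
  `canonicalStrictification_gStrict` — the same at universe `0` (the registered sub-goal).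

## Sources

* A. J. de Jong, *Smoothness, semi-stability and alterations*, Publ. Math. IHÉS 83 (1996),
  2.4 (p. 55), 7.2 (pp. 87–88). [DeJong1996]
-/

-- single-problem summit: the doubled namespace component `ResolutionOfSingularities` is forced
set_option linter.dupNamespace false

noncomputable section

open CategoryTheory CategoryTheory.Limits AlgebraicGeometry TopologicalSpace IsLocalRing
open Literature.AlgebraicGeometry.Resolution
open Scheme.IdealSheafData

universe u

namespace Summit.ResolutionOfSingularities.ResolutionOfSingularities.Theorems

variable {S S₁ : Scheme.{u}} {φ : S₁ ⟶ S}

/-! ## The local equation of the exceptional divisor -/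

/-- The exceptional divisor of a blowing up is locally principal: at every `s₁ ∈ S₁` the stalk
of `I · 𝒪_{S₁}` is generated by one element (`IsBlowup.isEffectiveCartier`). [folklore] -/
theorem exists_generator_exceptional {I : S.IdealSheafData} (hφ : IsBlowup φ I) (s₁ : S₁) :
    ∃ g₀ : S₁.presheaf.stalk s₁, stalkIdeal (I.comap φ) s₁ = Ideal.span {g₀} := by
  obtain ⟨U, hxU, f, -, hfU⟩ := hφ.isEffectiveCartier s₁
  refine ⟨(S₁.presheaf.germ U _ hxU).hom f, ?_⟩
  rw [stalkIdeal_eq_map_germ _ U hxU, hfU, Ideal.map_span, Set.image_singleton]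

/-- Over the (reduced) centre `C` a local equation `g₀` of the exceptional divisor is not a
unit: `s₁ ∈ φ⁻¹C = Supp(I_C · 𝒪_{S₁})` means `(g₀) ⊆ 𝔪_{s₁}`. [folklore] -/
theorem not_isUnit_of_mem_centre {C : Set S} (hC : IsClosed C) {s₁ : S₁}
    {g₀ : S₁.presheaf.stalk s₁}
    (hg₀ : stalkIdeal ((vanishingIdeal ⟨C, hC⟩).comap φ) s₁ = Ideal.span {g₀}) (hs : φ s₁ ∈ C) :
    ¬ IsUnit g₀ := by
  intro hu
  have hmem : s₁ ∈ ((vanishingIdeal ⟨C, hC⟩).comap φ).support := by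
    rw [support_comap]
    change φ s₁ ∈ ((vanishingIdeal (⟨C, hC⟩ : Closeds S)).support : Set S)
    rw [coe_support_vanishingIdeal]
    exact hs
  rw [mem_support_iff_stalkIdeal_le, hg₀, Ideal.span_singleton_le_iff_mem] at hmem
  exact (IsLocalRing.mem_maximalIdeal _).mp hmem hu

/-- A one-element part of a regular system of parameters generates a prime ideal. [folklore] -/
theorem isPrime_span_prod_of_isRsopPart_one {R : Type u} [CommRing R] [IsLocalRing R]
    {y : Fin 1 → R} (hy : IsRsopPart y) : (Ideal.span {∏ i, y i}).IsPrime := by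
  rw [Fin.prod_univ_one]
  exact (Ideal.span_singleton_prime (hy.ne_zero 0)).mpr (hy.prime 0)

/-! ## The consequences of the local equations of `φ⁻¹(F ∪ C)` -/

section Consequences

variable {Z F C : Set S} (hC : IsClosed C) (hφ : IsBlowup φ (vanishingIdeal ⟨C, hC⟩))
  (hZnc : IsNormalCrossingsDivisor S Z) (hF : IsStrictNormalCrossingsDivisor S F) (hFZ : F ⊆ Z)
  (hCZ : C ⊆ Z)
  (hpt : ∀ s₁ ∈ φ ⁻¹' (F ∪ C), ∀ g₀ : S₁.presheaf.stalk s₁,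
    stalkIdeal ((vanishingIdeal ⟨C, hC⟩).comap φ) s₁ = Ideal.span {g₀} →
      ∀ (n : ℕ) (x₀ : Fin n → S.presheaf.stalk (φ s₁)), IsRsopPart x₀ →
        stalkIdeal (vanishingIdeal ⟨closure F, isClosed_closure⟩) (φ s₁) =
            Ideal.span {∏ i, x₀ i} →
          (IsUnit g₀ →
            IsRsopPart ((φ.stalkMap s₁).hom ∘ x₀) ∧
              stalkIdeal (vanishingIdeal ⟨closure (φ ⁻¹' (F ∪ C)), isClosed_closure⟩) s₁ =
                Ideal.span {∏ i, (φ.stalkMap s₁).hom (x₀ i)}) ∧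
          (¬ IsUnit g₀ →
            IsRsopPart (Fin.cons g₀ ((φ.stalkMap s₁).hom ∘ x₀) : Fin (n + 1) → _) ∧
              stalkIdeal (vanishingIdeal ⟨closure (φ ⁻¹' (F ∪ C)), isClosed_closure⟩) s₁ =
                Ideal.span {∏ i, (Fin.cons g₀ ((φ.stalkMap s₁).hom ∘ x₀) :
                  Fin (n + 1) → _) i}))

include hZnc hF in
/-- Regular parameters cutting out `F` at a point `s ∈ Z` (none if `s ∉ F`, where
`I(F)_s = 𝒪_{S,s}` and `𝒪_{S,s}` is regular as `s` lies on the normal crossings divisor `Z`).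
[folklore] -/
theorem exists_isRsopPart_marked [IsLocallyNoetherian S] {s : S} (hsZ : s ∈ Z) :
    ∃ (n : ℕ) (x₀ : Fin n → S.presheaf.stalk s), IsRsopPart x₀ ∧
      stalkIdeal (vanishingIdeal ⟨closure F, isClosed_closure⟩) s = Ideal.span {∏ i, x₀ i} ∧
        (s ∈ F → 1 ≤ n) := by
  by_cases hsF : s ∈ F
  · obtain ⟨r, x, hr, hx, hI⟩ :=
      (isSNCIdeal_iff_exists_isRsopPart _).mp (hF.isStrictNormalCrossingsAt hsF)
    exact ⟨r, x, hx, hI, fun _ => hr⟩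
  · haveI := hZnc.isRegularLocalRing hsZ
    refine ⟨0, Fin.elim0, isRsopPart_of_isRegularLocalRing_zero _, ?_, fun h => (hsF h).elim⟩
    rw [Finset.univ_eq_empty, Finset.prod_empty, Ideal.span_singleton_one,
      stalkIdeal_eq_top_of_not_mem_support]
    intro hmem
    apply hsF
    have hmem' : s ∈ ((vanishingIdeal (⟨closure F, isClosed_closure⟩ : Closeds S)).support :
      Set S) := hmem
    rw [coe_support_vanishingIdeal] at hmem'
    change s ∈ closure F at hmem'
    rwa [hF.isClosed.closure_eq] at hmem'

include hφ hZnc hF hFZ hCZ hpt in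
/-- **`φ⁻¹(F ∪ C)` is a strict normal crossings divisor**: at `s₁` over `F ∪ C`, its ideal is
generated by the product of the part `(g₀, φ^* x)` (or `φ^* x`) of a regular system of
parameters, non-empty since either `g₀` is not a unit or `φ s₁ ∈ F` and `x` is non-empty.
(As in `DeJong1996NormalCrossingsBlowupStep.of_sncBlowupTopStratum`.) [cite: DeJong1996, 2.4, p. 55] -/
theorem isStrictNormalCrossingsDivisor_preimage_union [IsLocallyNoetherian S] :
    IsStrictNormalCrossingsDivisor S₁ (φ ⁻¹' (F ∪ C)) := by
  have hF₁c : IsClosed (φ ⁻¹' (F ∪ C)) := (hF.isClosed.union hC).preimage φ.continuous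
  refine IsStrictNormalCrossingsDivisor.of_forall_isStrictNormalCrossingsAt hF₁c fun s₁ hs₁ => ?_
  have hsZ : φ s₁ ∈ Z := (Set.union_subset hFZ hCZ) hs₁
  obtain ⟨g₀, hg₀⟩ := exists_generator_exceptional hφ s₁
  obtain ⟨n, x₀, hx₀, hIx₀, hn⟩ := exists_isRsopPart_marked hZnc hF hsZ
  have D := hpt s₁ hs₁ g₀ hg₀ n x₀ hx₀ hIx₀
  change IsSNCIdeal _
  rw [isSNCIdeal_iff_exists_isRsopPart]
  by_cases hu : IsUnit g₀
  · obtain ⟨hr, hI⟩ := D.1 hu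
    have hsF : φ s₁ ∈ F := by
      rcases hs₁ with h | h
      · exact h
      · exact (not_isUnit_of_mem_centre hC hg₀ h hu).elim
    exact ⟨n, _, hn hsF, hr, hI⟩
  · obtain ⟨hr, hI⟩ := D.2 hu
    exact ⟨n + 1, _, Nat.succ_pos n, hr, hI⟩

include hφ hZnc hF hCZ hpt in
/-- **The exceptional divisor `φ⁻¹C` is a regular piece**: at `s₁ ∈ φ⁻¹C` the local equation
`g₀` is not a unit, it is a member of the part `(g₀, φ^* x)` of a regular system of parameters,
and `I(φ⁻¹C)_{s₁} = √(I_C · 𝒪_{S₁,s₁}) = √(g₀) = (g₀)`. [cite: DeJong1996, 7.2, pp. 87–88] -/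
theorem regularPiece_exceptional [IsLocallyNoetherian S] :
    IsClosed (φ ⁻¹' C) ∧ ∀ s₁ ∈ φ ⁻¹' C, ∃ y : Fin 1 → S₁.presheaf.stalk s₁, IsRsopPart y ∧
      stalkIdeal (vanishingIdeal ⟨closure (φ ⁻¹' C), isClosed_closure⟩) s₁ =
        Ideal.span {∏ i, y i} := by
  refine ⟨hC.preimage φ.continuous, fun s₁ hs₁ => ?_⟩
  have hsC : φ s₁ ∈ C := hs₁
  obtain ⟨g₀, hg₀⟩ := exists_generator_exceptional hφ s₁
  have hu : ¬ IsUnit g₀ := not_isUnit_of_mem_centre hC hg₀ hsC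
  obtain ⟨n, x₀, hx₀, hIx₀, -⟩ := exists_isRsopPart_marked hZnc hF (hCZ hsC)
  obtain ⟨hr, -⟩ := (hpt s₁ (Or.inr hsC) g₀ hg₀ n x₀ hx₀ hIx₀).2 hu
  -- the one-element sub-family `(g₀)`
  have hy : IsRsopPart (fun _ : Fin 1 => g₀) := by
    have := hr.comp (fun _ : Fin 1 => (0 : Fin (n + 1))) (Function.injective_of_subsingleton _)
    convert this using 1
    funext i
    simp only [Function.comp_apply, Fin.cons_zero]
  refine ⟨fun _ => g₀, hy, ?_⟩
  have hprime : (Ideal.span {g₀}).IsPrime := by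
    have := isPrime_span_prod_of_isRsopPart_one hy
    rwa [Fin.prod_univ_one] at this
  rw [Fin.prod_univ_one, stalkIdeal_vanishingIdeal_closure_preimage φ hC s₁]
  have hcl : (⟨closure C, isClosed_closure⟩ : Closeds S) = ⟨C, hC⟩ := Closeds.ext hC.closure_eq
  rw [hcl, ← stalkIdeal_comap_eq_map_stalkMap, hg₀]
  exact hprime.radical

include hφ hF hpt in
/-- **The preimage of a regular piece `P ⊆ F` is a regular piece.** At `s₁ ∈ φ⁻¹P`, match the
local equation of `P` at `t = φ s₁` with the branches of `F` (`exists_matched_rsop`: regular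
parameters `(f ; g)` with `I(F)_t = (f · ∏ g)`, `I(P)_t = (f)`, one `f` as `P` has one branch);
by the local equations of `φ⁻¹(F ∪ C)` the pulled-back family (with `g₀` in front if it is not a
unit) is part of a regular system of parameters at `s₁`, in particular so is `φ^* f`, and
`I(φ⁻¹P)_{s₁} = √(φ^* f) = (φ^* f)`. [cite: DeJong1996, 7.2, pp. 87–88] -/
theorem regularPiece_preimage {P : Set S} (hPF : P ⊆ F) (hPc : IsClosed P)
    (hP : ∀ s ∈ P, ∃ y : Fin 1 → S.presheaf.stalk s, IsRsopPart y ∧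
      stalkIdeal (vanishingIdeal ⟨closure P, isClosed_closure⟩) s = Ideal.span {∏ i, y i}) :
    IsClosed (φ ⁻¹' P) ∧ ∀ s₁ ∈ φ ⁻¹' P, ∃ y : Fin 1 → S₁.presheaf.stalk s₁, IsRsopPart y ∧
      stalkIdeal (vanishingIdeal ⟨closure (φ ⁻¹' P), isClosed_closure⟩) s₁ =
        Ideal.span {∏ i, y i} := by
  refine ⟨hPc.preimage φ.continuous, fun s₁ hs₁ => ?_⟩
  have htP : φ s₁ ∈ P := hs₁
  have htF : φ s₁ ∈ F := hPF htP
  obtain ⟨y, hy, hIy⟩ := hP _ htP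
  have hPt : IsStrictNormalCrossingsAt S P (φ s₁) :=
    (isSNCIdeal_iff_exists_isRsopPart _).mpr ⟨1, y, le_rfl, hy, hIy⟩
  obtain ⟨k, n, f, g, -, hfg, hIF, hIP⟩ :=
    exists_matched_rsop hPF hPc (hF.isStrictNormalCrossingsAt htF) fun _ => hPt
  -- `P` has exactly one branch at `t`, so `k = 1`
  have hk : k = 1 := by
    have h1 := (branchOrder_eq_of_matched hfg hIF hIP).2
    rw [branchOrder_eq_of_isRsopPart hy hIy] at h1
    exact_mod_cast h1.symm
  subst hk
  -- the local equations of `φ⁻¹(F ∪ C)` for `x₀ = (f ; g)`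
  obtain ⟨g₀, hg₀⟩ := exists_generator_exceptional hφ s₁
  have hIx₀ : stalkIdeal (vanishingIdeal ⟨closure F, isClosed_closure⟩) (φ s₁) =
      Ideal.span {∏ i, Fin.append f g i} := by
    rw [hIF, Fin.prod_univ_add]
    simp
  have D := hpt s₁ (Or.inl htF) g₀ hg₀ (1 + n) (Fin.append f g) hfg hIx₀
  -- `φ^* f` is part of a regular system of parameters at `s₁`
  set y₁ : Fin 1 → S₁.presheaf.stalk s₁ := fun _ => (φ.stalkMap s₁).hom (f 0) with hy₁def
  have hy₁ : IsRsopPart y₁ := by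
    by_cases hu : IsUnit g₀
    · have := (D.1 hu).1.comp (fun _ : Fin 1 => Fin.castAdd n (0 : Fin 1))
        (Function.injective_of_subsingleton _)
      convert this using 1
      funext i
      simp only [hy₁def, Function.comp_apply, Fin.append_left]
    · have := (D.2 hu).1.comp (fun _ : Fin 1 => Fin.succ (Fin.castAdd n (0 : Fin 1)))
        (Function.injective_of_subsingleton _)
      convert this using 1
      funext i
      simp only [hy₁def, Function.comp_apply, Fin.cons_succ, Fin.append_left]
  refine ⟨y₁, hy₁, ?_⟩
  have hprime : (Ideal.span {(φ.stalkMap s₁).hom (f 0)}).IsPrime := by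
    have := isPrime_span_prod_of_isRsopPart_one hy₁
    rwa [Fin.prod_univ_one] at this
  rw [Fin.prod_univ_one, hy₁def, stalkIdeal_vanishingIdeal_closure_preimage φ hPc s₁, hIP,
    Fin.prod_univ_one, Ideal.map_span, Set.image_singleton]
  exact hprime.radical

end Consequences

/-! ## `G`-strictness from regular pieces -/

/-- Maximal points of a stable closed subset are permuted by an automorphism. [folklore] -/
theorem mem_maxPoints_of_aut (σ : S ≅ S) {D : Set S} (hD : σ.hom.base ⁻¹' D = D) {η : S}
    (hη : η ∈ maxPoints D) : σ.hom.base η ∈ maxPoints D := by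
  refine ⟨by rw [← Set.mem_preimage, hD]; exact hη.1, fun η' hη'D hsp => ?_⟩
  have h1 : σ.inv.base η' ⤳ η := by
    have := hsp.map σ.inv.continuous
    rwa [Scheme.hom_inv_apply] at this
  have h2 : σ.inv.base η' ∈ D := by
    rw [← hD, Set.mem_preimage, Scheme.inv_hom_apply]
    exact hη'D
  have h3 : σ.inv.base η' = η := hη.2 _ h2 h1
  rw [← h3, Scheme.inv_hom_apply]

/-- **`G`-strictness of a union of stable regular pieces** (de Jong 1996, 7.1–7.2: "all the
components in one `G`-orbit … are of the same type … these do not intersect"). Let `σ` be an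
automorphism of `S`, `D = ⋃₀ Ps` a closed union of `σ`-stable closed subsets `P` each of which is
locally irreducible (the ideal of `P` at each of its points is prime), and `K` an irreducible
component of `D` (a maximal irreducible subset) meeting `σK`. Then `σK = K`. Proof: `K` is closed
with generic point `η`, a maximal point of `D`; `η` lies on some piece `P`, hence so does `ση`;
at `t ∈ K ∩ σK` the prime `𝔭_η ⊆ 𝒪_{S,t}` is minimal over `I(D)_t` and contains the prime
`I(P)_t`, so `𝔭_η = I(P)_t ⊆ 𝔭_{ση}`, i.e. `η ⤳ ση`; as `ση` is again a maximal point of `D`,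
`η = ση`, whence `σK = cl{ση} = cl{η} = K`. [cite: DeJong1996, 7.1–7.2, pp. 87–88] -/
theorem image_eq_of_regularPieces (σ : S ≅ S) {D : Set S} (hDc : IsClosed D)
    (Ps : Set (Set S)) (hDPs : D = ⋃₀ Ps)
    (hPs : ∀ P ∈ Ps, σ.hom.base ⁻¹' P = P ∧ IsClosed P ∧
      ∀ s ∈ P, (stalkIdeal (vanishingIdeal ⟨closure P, isClosed_closure⟩) s).IsPrime)
    {K : Set S} (hK : Maximal (fun K : Set S => IsIrreducible K ∧ K ⊆ D) K)
    (hne : (K ∩ σ.hom.base '' K).Nonempty) : σ.hom.base '' K = K := by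
  -- `D` is stable
  have hDst : σ.hom.base ⁻¹' D = D := by
    ext x
    rw [hDPs, Set.mem_preimage, Set.mem_sUnion, Set.mem_sUnion]
    constructor
    · rintro ⟨P, hP, hx⟩
      exact ⟨P, hP, by rwa [← Set.mem_preimage, (hPs P hP).1] at hx⟩
    · rintro ⟨P, hP, hx⟩
      exact ⟨P, hP, by rw [← Set.mem_preimage, (hPs P hP).1]; exact hx⟩
  -- `K` is closed, with generic point `η`; `σK` is closed with generic point `ση`
  have hKc : IsClosed K :=
    closure_subset_iff_isClosed.mp (hK.2 ⟨hK.1.1.closure, closure_minimal hK.1.2 hDc⟩ subset_closure)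
  set η : S := hK.1.1.genericPoint with hηdef
  have hη : IsGenericPoint η K := hK.1.1.isGenericPoint_genericPoint hKc
  have hσKc : IsClosed (σ.hom.base '' K) := (Scheme.homeoOfIso σ).isClosed_image.mpr hKc
  have hση : IsGenericPoint (σ.hom.base η) (σ.hom.base '' K) := by
    have h := hη.image σ.hom.continuous
    rwa [hσKc.closure_eq] at h
  obtain ⟨t, htK, htσK⟩ := hne
  have hηt : η ⤳ t := hη.specializes htK
  have hσηt : σ.hom.base η ⤳ t := hση.specializes htσK
  -- the piece through `η`
  have hηD : η ∈ ⋃₀ Ps := hDPs ▸ hK.1.2 hη.mem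
  obtain ⟨P, hPPs, hηP⟩ := Set.mem_sUnion.mp hηD
  obtain ⟨hPst, hPc, hPprime⟩ := hPs P hPPs
  have hσηP : σ.hom.base η ∈ P := by rw [← Set.mem_preimage, hPst]; exact hηP
  have htP : t ∈ P := hηt.mem_closed hPc hηP
  have hclP : (⟨closure P, isClosed_closure⟩ : Closeds S) = ⟨P, hPc⟩ := Closeds.ext hPc.closure_eq
  have hJ : (stalkIdeal (vanishingIdeal ⟨P, hPc⟩) t).IsPrime := hclP ▸ hPprime t htP
  have hJη : stalkIdeal (vanishingIdeal ⟨P, hPc⟩) t ≤ primeOfSpecializes hηt :=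
    stalkIdeal_vanishingIdeal_le hηt hηP
  have hJση : stalkIdeal (vanishingIdeal ⟨P, hPc⟩) t ≤ primeOfSpecializes hσηt :=
    stalkIdeal_vanishingIdeal_le hσηt hσηP
  -- `η` is a maximal point of `D`, so `𝔭_η` is minimal over `I(D)_t`, hence `= I(P)_t`
  have hηmax : η ∈ maxPoints D := by
    refine ⟨hK.1.2 hη.mem, fun η' hη'D hη'η => ?_⟩
    have h1 : K ⊆ closure {η'} := by
      rw [← hη.def]
      exact closure_minimal (Set.singleton_subset_iff.mpr hη'η.mem_closure) isClosed_closure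
    have h2 : closure {η'} ⊆ K :=
      hK.2 ⟨isIrreducible_singleton.closure,
        closure_minimal (Set.singleton_subset_iff.mpr hη'D) hDc⟩ h1
    have h3 : η ⤳ η' := hη.specializes (h2 (subset_closure (Set.mem_singleton η')))
    exact (hη'η.antisymm h3).eq
  have hmin := primeOfSpecializes_mem_minimalPrimes_of_mem_maxPoints (Z := ⟨D, hDc⟩) hηmax hηt
  have hDJ : stalkIdeal (vanishingIdeal ⟨D, hDc⟩) t ≤ stalkIdeal (vanishingIdeal ⟨P, hPc⟩) t :=
    stalkIdeal_mono (vanishingIdeal_antimono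
      (show ((⟨P, hPc⟩ : Closeds S) : Set S) ⊆ (⟨D, hDc⟩ : Closeds S) from
        hDPs ▸ Set.subset_sUnion_of_mem hPPs)) t
  have hηJ : primeOfSpecializes hηt = stalkIdeal (vanishingIdeal ⟨P, hPc⟩) t :=
    le_antisymm (hmin.2 ⟨hJ, hDJ⟩ hJη) hJη
  -- hence `η ⤳ ση`, and `ση` being maximal too, `η = ση`
  have hsp : η ⤳ σ.hom.base η :=
    specializes_of_primeOfSpecializes_le hσηt hηt (hηJ ▸ hJση)
  have heq : η = σ.hom.base η := (mem_maxPoints_of_aut σ hDst hηmax).2 η (hK.1.2 hη.mem) hsp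
  rw [← hση.def, ← heq, hη.def]


/-- **`G`-strictness of a union of stable regular pieces, packaged at universe `0`** (the form
registered as a sub-goal of stub `stub_pair_canonicalStrictification`); see
`image_eq_of_regularPieces`. [cite: DeJong1996, 7.1–7.2, pp. 87–88] -/
theorem canonicalStrictification_gStrict (S : Scheme.{0}) (σ : S ≅ S) (D : Set S)
    (hDc : IsClosed D) (Ps : Set (Set S)) (hDPs : D = ⋃₀ Ps)
    (hPs : ∀ P ∈ Ps, σ.hom.base ⁻¹' P = P ∧ IsClosed P ∧ ∀ s ∈ P,
      (stalkIdeal (Scheme.IdealSheafData.vanishingIdeal ⟨closure P, isClosed_closure⟩) s).IsPrime)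
    (K : Set S) (hK : Maximal (fun K : Set S => IsIrreducible K ∧ K ⊆ D) K)
    (hne : (K ∩ σ.hom.base '' K).Nonempty) : σ.hom.base '' K = K :=
  image_eq_of_regularPieces σ hDc Ps hDPs hPs hK hne

end Summit.ResolutionOfSingularities.ResolutionOfSingularities.Theorems

end
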